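import Literature.IUT.HodgeArakelov.AbsTopInterfaces
import Literature.IUT.HodgeArakelov.MonoThetaCor110SubdagStatements

/-!
# [IUTchII] §1, Example 1.8 (vi): the exterior-cyclotomic multiradial environment — proofs

S. Mochizuki, *Inter-universal Teichmüller theory II: Hodge–Arakelov-theoretic evaluation*, §1, Example 1.8
(vi), kurims manuscript (Dec. 2020) p. 40, l. 20–25 of the cell's render: "(vi) By replacing the notation
`M^μ_TM(Π)` in the discussion of (v) by the notation `Π_μ(M^Θ_*(Π)) ⊗ ℚ/ℤ` [cf. Propositions 1.2, (i); 1.5, (i),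
(iii)], one verifies immediately that one obtains an 'exterior-cyclotomic version' of the multiradial
environment constructed in (v)." [claim: Mochizuki2012, status: disputed] (IUTchII §1 Ex 1.8 (vi), kurims p.40).
Record-only, PROOF-ONLY companion (abc-iut cell, cone node `IUTchII:Ex1.8(vi)`, DISCHARGE-W1 §0): no definition,
no new `Prop`; it imports the typing of record (`RadialExamples`, `RadialGraphs`, `AbsTopInterfaces`,
`MonoThetaProjective`, `MonoThetaCor110SubdagStatements`) and proves the printed clauses of (vi) — i.e. the
clauses of (v) (kurims p. 39 l. 26 – p. 40 l. 19) read with `Π_μ(M^Θ_*(Π)) ⊗ ℚ/ℤ` in place of `M^μ_TM(Π)` — over it.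

WHAT IS PROVED.
* In the typing of record the environment of (v)/(vi) is the SHAPE `ex18iii S Γ^{×μ}` (radial data indexed by
  `(Π, G)`; isomorphisms = (isomorphism `Π ⥲ Π*`, `Γ^{×μ}`-multiple of an isomorphism `G ⥲ G*`); coric data
  `TwistedIsoClass S.Gk Γ^{×μ}`; radial algorithm the projection) — it is the `(ℛ, 𝒞, Φ)` "in the notation of
  Example 1.8, (v), (vi)" of Corollary 1.10 (`cor110Dagger`) — the reduction "output `Ξ(Π)` of a functorial
  group-theoretic algorithm `Ξ` on isomorphs of `Π^tp_{X̲̲_k}` ↦ the isomorph `Π`" being Example 1.9 (i)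
  (`Functor.Graph.toBase`: full, faithful, essentially surjective). Below the reduction is NOT taken: for ANY
  functorial group-theoretic algorithm `Ξ : IsoClass Π^tp_{X̲̲_k} ⥤ F` — for (vi) `Ξ(Π) = (Π ↷ Π_μ(M^Θ_*(Π)) ⊗ ℚ/ℤ)`
  (Props. 1.2 (i), 1.5 (i), (iii)) — the environment whose radial data are the objects `(Π ↷ Ξ(Π))` of the GRAPH
  of `Ξ` (Ex. 1.9 (i)) paired with coric data `(G ↷ O^{×μ}(G))` is connected on the `Π`-side
  (`Functor.Graph.nonempty_hom_of_forall`, `ex18vi_nonempty_hom`: "induced by an isomorphism `Π ⥲ Π*`") and has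
  FULL and ESSENTIALLY SURJECTIVE radial functor, i.e. IS a multiradial environment: product form
  `pairEnvironment (Functor.Graph Ξ) (TwistedIsoClass S.Gk Γ^{×μ})` (`ex18vi_isMultiradial`,
  `ex18vi_full_and_essSurj`), and graph-over-the-shape form `(ex18iii S Γ^{×μ}).dagger (Prod.fst ⋙ Ξ)` of
  Example 1.9 (ii) (`ex18vi_dagger_isMultiradial`); in particular for the tree's carrier of the specific
  algorithm `Π ↦ (Π, (l·Δ_Θ)(Π), Π_μ(M^Θ_*(Π)), (∗mono-Θ_Π))` (`MonoThetaRigidityData.toRigidityFunctor`), the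
  daggered environment `D.dagger Γ^{×μ}` of Corollary 1.10 over (vi) is multiradial
  (`MonoThetaRigidityData.dagger_isMultiradial`). The printed "one verifies immediately" is: a composite of full
  functors is full.
* The comparison `α_{μ,×μ}` of (v)/(vi) is "determined by the full poly-isomorphism `Π/Δ ⥲ G` and the trivial
  homomorphism" `Π_μ(M^Θ_*(Π)) ⊗ ℚ/ℤ → O^{×μ}(G)` (p. 39; recalled in Remark 1.10.2, Fig. 1.4). PROVED over the
  [AbsTopIII] interface `A : AbsTopMonoids S`: the tree's carrier `Q` of `Π_μ(M^Θ_*) ⊗ ℚ/ℤ` (an abstract group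
  with the Kummer injection of Remark 1.5.2, `Rmk152_kummerTorsion`) is a TORSION group
  (`isTorsion_of_rmk152_kummerTorsion`), and EVERY homomorphism from a torsion group to `O^×(G)` becomes trivial
  in `O^{×μ}(G) = O^×(G)/O^μ(G)` (`AbsTopMonoids.oxmu_mk_eq_one_of_isTorsion`, `ex18vi_hom_to_oxmu_trivial`); hence
  the printed "[so one verifies immediately that these isomorphisms are compatible with `α_{μ,×μ}`,
  `α*_{μ,×μ}` in the evident sense]" for the trivial-homomorphism component (`ex18vi_isos_compatible`: the square
  commutes for every pair of isomorphisms, the composites being trivial).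

NOT here (interface level, recorded for the node's coverage): the ind-topological `Π`-module
`Π_μ(M^Θ_*(Π)) ⊗ ℚ/ℤ` as the value of ONE specific functor on `IsoClass Π^tp_{X̲̲_k}` — the tree carries
`Π ↷ Π_μ(M^Θ_*(Π))` functorially in `Π` (`MonoThetaRigidityData.extCyc`, `.actExt`, `.mapExt`) and
`Π_μ(M^Θ_*) ⊗ ℚ/ℤ` as an abstract group with its Kummer injection (`Rmk152_kummerTorsion`, `MuXmuDiagram`); the
theorems below therefore quantify over all `Ξ`, resp. all torsion `Q`. No side taken on [IUTchIII] Cor. 3.12;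
typed ≠ proved; nothing here bears on abc.
-/

namespace Literature.IUT.HodgeArakelov

open CategoryTheory

universe v v' u u'

/-! ## Example 1.9 (i) bookkeeping: the graph of an algorithm on a connected groupoid is connected -/

namespace Functor.Graph

/-- If any two objects of `ℰ` are joined by a morphism, then so are any two objects `(E, Ξ(E))`, `(E', Ξ(E'))`
of the graph of `Ξ : ℰ → ℱ` (Example 1.9 (i): the morphisms of the graph are "the pairs of arrows
`(f : E → E', Ξ(f))`"). PROVED. [claim: Mochizuki2012, status: disputed] (IUTchII §1 Ex 1.9 (i), kurims p.42) -/
theorem nonempty_hom_of_forall {E : Type u} [Category.{v} E] {F : Type u'} [Category.{v'} F] (Ξ : E ⥤ F)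
    (h : ∀ X Y : E, Nonempty (X ⟶ Y)) (X Y : Functor.Graph Ξ) : Nonempty (X ⟶ Y) :=
  (h X Y).map fun f => (Functor.Graph.ofBase Ξ).map f

end Functor.Graph

section Multiradial

variable (S : ThetaSetting.{u}) (Γxμ : Type u) [Group Γxμ] {F : Type u'} [Category.{v'} F]

/-- **IUTchII:Ex1.8(vi)**, `Π`-side isomorphisms (kurims p. 39 l. 58 – p. 40 l. 1, read for (vi)): "the
isomorphism `(Π ↷ Π_μ(M^Θ_*(Π)) ⊗ ℚ/ℤ) ⥲ (Π* ↷ Π_μ(M^Θ_*(Π*)) ⊗ ℚ/ℤ)` induced by an isomorphism of topological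
groups `Π ⥲ Π*`" — for any functorial group-theoretic algorithm `Ξ` on isomorphs of `Π^tp_{X̲̲_k}`, any two
objects `(Π ↷ Ξ(Π))` of its graph are isomorphic. PROVED (`IsoClass.nonempty_hom`).
[claim: Mochizuki2012, status: disputed] (IUTchII §1 Ex 1.8 (vi), kurims p.40) -/
theorem ex18vi_nonempty_hom (Ξ : IsoClass S.PiX ⥤ F) (X Y : Functor.Graph Ξ) : Nonempty (X ⟶ Y) :=
  Functor.Graph.nonempty_hom_of_forall Ξ IsoClass.nonempty_hom X Y

/-- **IUTchII:Ex1.8(vi)** (kurims p. 40 l. 20–25): "one verifies immediately that one obtains an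
'exterior-cyclotomic version' of the multiradial environment constructed in (v)" — with radial data the pairs
`((Π ↷ Ξ(Π)), (G ↷ O^{×μ}(G)))` (objects of the graph of the `Π`-side algorithm `Ξ`, e.g.
`Ξ(Π) = Π_μ(M^Θ_*(Π)) ⊗ ℚ/ℤ`, and of `TwistedIsoClass S.Gk Γ^{×μ}`), isomorphisms the pairs (induced by `Π ⥲ Π*`,
`Γ^{×μ}`-multiple of induced by `G ⥲ G*`), coric data `(G ↷ O^{×μ}(G))`, radial algorithm the projection, the radial
functor is FULL: the environment is multiradial. PROVED for every `Ξ`.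
[claim: Mochizuki2012, status: disputed] (IUTchII §1 Ex 1.8 (vi), kurims p.40) -/
theorem ex18vi_isMultiradial (Ξ : IsoClass S.PiX ⥤ F) :
    haveI : Nonempty (Functor.Graph Ξ) := ⟨(Functor.Graph.ofBase Ξ).obj (IsoClass.base S.PiX)⟩
    (pairEnvironment (Functor.Graph Ξ) (TwistedIsoClass S.Gk Γxμ)).IsMultiradial :=
  haveI : Nonempty (Functor.Graph Ξ) := ⟨(Functor.Graph.ofBase Ξ).obj (IsoClass.base S.PiX)⟩
  pairEnvironment_isMultiradial _ _ (ex18vi_nonempty_hom S Ξ)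

/-- **IUTchII:Ex1.8(vi)** via (v) (kurims p. 40 l. 18–19): "whose associated radial functor is full and
essentially surjective, hence determines a multiradial environment" — both halves, for the exterior-cyclotomic
data of (vi) in the graph model (any `Π`-side algorithm `Ξ`). PROVED.
[claim: Mochizuki2012, status: disputed] (IUTchII §1 Ex 1.8 (vi), kurims p.40) -/
theorem ex18vi_full_and_essSurj (Ξ : IsoClass S.PiX ⥤ F) :
    haveI : Nonempty (Functor.Graph Ξ) := ⟨(Functor.Graph.ofBase Ξ).obj (IsoClass.base S.PiX)⟩
    (pairEnvironment (Functor.Graph Ξ) (TwistedIsoClass S.Gk Γxμ)).Φ.Full ∧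
      (pairEnvironment (Functor.Graph Ξ) (TwistedIsoClass S.Gk Γxμ)).Φ.EssSurj :=
  ⟨ex18vi_isMultiradial S Γxμ Ξ, RadialEnvironment.essSurj _⟩

/-- **IUTchII:Ex1.8(vi)**, graph-over-the-shape form (Example 1.9 (i), (ii)): attaching the output `Ξ(Π)` of a
functorial group-theoretic algorithm `Ξ` — for (vi), `Π ↦ (Π ↷ Π_μ(M^Θ_*(Π)) ⊗ ℚ/ℤ)` — to the radial data of the
shape environment `ex18iii S Γ^{×μ}` of (v) (the tree's `RadialEnvironment.dagger`) yields again a MULTIRADIAL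
environment: its radial functor `(Π ↷ Ξ(Π), G ↷ O^{×μ}(G)) ↦ (G ↷ O^{×μ}(G))` is the composite of the full functor
"forget `Ξ(Π)`" with the full radial functor of (v). PROVED for every `Ξ`.
[claim: Mochizuki2012, status: disputed] (IUTchII §1 Ex 1.8 (vi), kurims p.40) -/
theorem ex18vi_dagger_isMultiradial (Ξ : IsoClass S.PiX ⥤ F) :
    ((ex18iii S Γxμ).dagger (CategoryTheory.Prod.fst _ _ ⋙ Ξ)).IsMultiradial := by
  haveI : (ex18iii S Γxμ).Φ.Full := ex18iii_isMultiradial S Γxμ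
  unfold RadialEnvironment.IsMultiradial RadialEnvironment.dagger
  exact Functor.Full.comp _ _

/-- **IUTchII:Ex1.8(vi)** at the tree's carrier of the SPECIFIC `Π`-side algorithm: for a functorial family `D`
of mono-theta cyclotomic rigidity data (`Π ↦ (Π, (l·Δ_Θ)(Π), Π_μ(M^Θ_*(Π)), (∗mono-Θ_Π))`, Props. 1.2 (i), 1.5 (iii);
`MonoThetaRigidityData`, sub-DAG C110-S2/S5), the daggered environment `(ℛ†, 𝒞, Φ†)` of Corollary 1.10 over the
exterior-cyclotomic environment of (vi) is multiradial. COROLLARY of `ex18vi_dagger_isMultiradial` (not a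
separately printed sentence). [claim: Mochizuki2012, status: disputed] (IUTchII §1 Ex 1.8 (vi), kurims p.40) -/
theorem MonoThetaRigidityData.dagger_isMultiradial {S : ThetaSetting.{u}} (D : MonoThetaRigidityData S)
    (Γxμ : Type u) [Group Γxμ] : (D.dagger Γxμ).IsMultiradial :=
  ex18vi_dagger_isMultiradial S Γxμ D.toRigidityFunctor.Ξ

end Multiradial

/-! ## The trivial homomorphism `Π_μ(M^Θ_*(Π)) ⊗ ℚ/ℤ → O^{×μ}(G)` -/

section TrivialHom

variable {S : ThetaSetting.{u}}

/-- Over the [AbsTopIII] interface: every homomorphism from a TORSION group `Q` to `O^×(G)` becomes trivial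
after `O^×(G) ↠ O^{×μ}(G) = O^×(G)/O^μ(G)` (`O^μ(G)` = the torsion subgroup, Example 1.8 (iv)) — the mechanism of the
"trivial homomorphism" of Example 1.8 (v)/(vi) (kurims p. 39 l. 41–48: "the composite of the natural
homomorphisms `M^μ_TM(Π) ⊆ M^×_TM(Π) ⥲ O^×(G) ↠ O^{×μ}(G)`"). PROVED.
[claim: Mochizuki2012, status: disputed] (IUTchII §1 Ex 1.8 (vi), kurims p.40) -/
theorem AbsTopMonoids.oxmu_mk_eq_one_of_isTorsion (A : AbsTopMonoids S) (G : IsoClass S.Gk) {Q : Type v}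
    [Group Q] (hQ : Monoid.IsTorsion Q) (φ : Q →* A.Ounits G) (q : Q) :
    (QuotientGroup.mk (φ q) : A.Oxmu G) = 1 := by
  rw [QuotientGroup.eq_one_iff]
  exact (CommGroup.mem_torsion _).mpr (φ.isOfFinOrder (hQ q))

/-- The tree's carrier `Q` of `Π_μ(M^Θ_*) ⊗ ℚ/ℤ` — an abstract group with the injection
`κ : Π_μ(M^Θ_*) ⊗ ℚ/ℤ ↪ lim_J H¹(Π_Ÿ(M^Θ_*)|_J, Π_μ(M^Θ_*))` of Remark 1.5.2 "whose image is equal to the torsion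
subgroup of the codomain" (`Rmk152_kummerTorsion`) — is a TORSION group. PROVED (injectivity transports finite
order back). [claim: Mochizuki2012, status: disputed] (IUTchII §1 Rmk 1.5.2, kurims pp.30-31) -/
theorem isTorsion_of_rmk152_kummerTorsion {F : ModelFamily S} {Sys : MonoThetaProjSystem F}
    (T : ThetaEnvData Sys) (Q : Type u) [AddCommGroup Q] (κ : Q →+ T.cohEnv.lim)
    (h : Rmk152_kummerTorsion T Q κ) : AddMonoid.IsTorsion Q := by
  intro q
  have hq : κ q ∈ Set.range κ := ⟨q, rfl⟩
  rw [h.2] at hq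
  exact (h.1.isOfFinAddOrder_iff).mp hq

/-- **IUTchII:Ex1.8(vi)**, the "trivial homomorphism" `Π_μ(M^Θ_*(Π)) ⊗ ℚ/ℤ → O^{×μ}(G)` determining
`α_{μ,×μ}` (kurims p. 39 l. 41–43, read for (vi); Remark 1.10.2): for the tree's carrier `Q` of
`Π_μ(M^Θ_*) ⊗ ℚ/ℤ` (Remark 1.5.2 datum `κ`) and ANY homomorphism `φ : Π_μ(M^Θ_*) ⊗ ℚ/ℤ → O^×(G)` (e.g. the composite
`⥲ M^μ_TM(Π) ⊆ M^×_TM(Π) ⥲ O^×(G)` through a representative of `α_×`), the composite with `O^×(G) ↠ O^{×μ}(G)` is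
trivial. PROVED. [claim: Mochizuki2012, status: disputed] (IUTchII §1 Ex 1.8 (vi), kurims p.40) -/
theorem ex18vi_hom_to_oxmu_trivial {F : ModelFamily S} {Sys : MonoThetaProjSystem F} (T : ThetaEnvData Sys)
    (Q : Type u) [AddCommGroup Q] (κ : Q →+ T.cohEnv.lim) (h : Rmk152_kummerTorsion T Q κ)
    (A : AbsTopMonoids S) (G : IsoClass S.Gk) (φ : Multiplicative Q →* A.Ounits G) :
    (QuotientGroup.mk' (A.Omu G)).comp φ = 1 := by
  have hQ : Monoid.IsTorsion (Multiplicative Q) := fun q =>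
    (isOfFinOrder_ofAdd_iff (α := Q) (x := Multiplicative.toAdd q)).mpr
      (isTorsion_of_rmk152_kummerTorsion T Q κ h (Multiplicative.toAdd q))
  ext q
  exact A.oxmu_mk_eq_one_of_isTorsion G hQ φ q

/-- **IUTchII:Ex1.8(vi)** via (v) (kurims p. 40 l. 7–9): "[so one verifies immediately that these isomorphisms
are compatible with `α_{μ,×μ}`, `α*_{μ,×μ}` in the evident sense]" — for the trivial-homomorphism component of
`α_{μ,×μ}`: for ANY isomorphism `e` of the `Π`-side carriers (e.g. induced by `Π ⥲ Π*`) and ANY isomorphism `f` of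
the `G`-side quotients `O^{×μ}(G) ⥲ O^{×μ}(G*)` (e.g. a `Γ^{×μ}`-multiple of the one induced by `G ⥲ G*`), the
square `f ∘ α = α* ∘ e` commutes, both composites being trivial. PROVED.
[claim: Mochizuki2012, status: disputed] (IUTchII §1 Ex 1.8 (vi), kurims p.40) -/
theorem ex18vi_isos_compatible {F : ModelFamily S} {Sys : MonoThetaProjSystem F} (T : ThetaEnvData Sys)
    (Q Q' : Type u) [AddCommGroup Q] [AddCommGroup Q'] (κ : Q →+ T.cohEnv.lim) (κ' : Q' →+ T.cohEnv.lim)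
    (h : Rmk152_kummerTorsion T Q κ) (h' : Rmk152_kummerTorsion T Q' κ')
    (A : AbsTopMonoids S) (G G' : IsoClass S.Gk)
    (φ : Multiplicative Q →* A.Ounits G) (φ' : Multiplicative Q' →* A.Ounits G')
    (e : Multiplicative Q ≃* Multiplicative Q') (f : A.Oxmu G ≃* A.Oxmu G') :
    f.toMonoidHom.comp ((QuotientGroup.mk' (A.Omu G)).comp φ) =
      ((QuotientGroup.mk' (A.Omu G')).comp φ').comp e.toMonoidHom := by
  rw [ex18vi_hom_to_oxmu_trivial T Q κ h A G φ, ex18vi_hom_to_oxmu_trivial T Q' κ' h' A G' φ',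
    MonoidHom.comp_one, MonoidHom.one_comp]

end TrivialHom

/-! ## Example 1.9 (i) for (vi): the graph model is EQUIVALENT to the shape of record, compatibly with `Φ` -/

section Equivalence

variable (S : ThetaSetting.{u}) (Γxμ : Type u) [Group Γxμ] {F : Type u'} [Category.{v'} F]

/-- Example 1.9 (i) bookkeeping: the natural functor `𝒢 → ℰ`, `(E, Ξ(E)) ↦ E`, from the graph of `Ξ : ℰ → ℱ` is an
EQUIVALENCE of categories (it is full, faithful and essentially surjective — `RadialGraphs`). PROVED.
[claim: Mochizuki2012, status: disputed] (IUTchII §1 Ex 1.9 (i), kurims p.42) -/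
theorem Functor.Graph.toBase_isEquivalence {E : Type u} [Category.{v} E] {F' : Type u'} [Category.{v'} F']
    (Ξ : E ⥤ F') : (Functor.Graph.toBase Ξ).IsEquivalence where

/-- **IUTchII:Ex1.8(vi)**, the reduction of record made kernel-exact: the radial functor of the exterior-cyclotomic
environment in the graph model, `(Π ↷ Ξ(Π), G ↷ O^{×μ}(G)) ↦ (G ↷ O^{×μ}(G))`, IS "forget `Ξ(Π)`" followed by the radial
functor of the shape environment `ex18iii S Γ^{×μ}` of (v) (definitional). [claim: Mochizuki2012, status: disputed]
(IUTchII §1 Ex 1.8 (vi), kurims p.40) -/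
theorem ex18vi_dagger_Φ (Ξ : IsoClass S.PiX ⥤ F) :
    ((ex18iii S Γxμ).dagger (CategoryTheory.Prod.fst _ _ ⋙ Ξ)).Φ =
      Functor.Graph.toBase (CategoryTheory.Prod.fst _ _ ⋙ Ξ) ⋙ (ex18iii S Γxμ).Φ :=
  rfl

/-- **IUTchII:Ex1.8(vi)** (`RadialExamples`, §"Example 1.8 (iv)–(ix)": "each of the remaining environments of Example
1.8 has — up to equivalence of its radial and coric categories — the SHAPE `ex18iii S Γ`"), kernel form for (vi): the
radial category of the graph-model exterior-cyclotomic environment is EQUIVALENT to that of `ex18iii S Γ^{×μ}` by the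
forgetful functor "forget `Ξ(Π)`" (the coric categories are equal), compatibly with the radial functors
(`ex18vi_dagger_Φ`). PROVED for every `Π`-side algorithm `Ξ`. [claim: Mochizuki2012, status: disputed]
(IUTchII §1 Ex 1.8 (vi), kurims p.40) -/
theorem ex18vi_toBase_isEquivalence (Ξ : IsoClass S.PiX ⥤ F) :
    (Functor.Graph.toBase (CategoryTheory.Prod.fst _ _ ⋙ Ξ) :
      ((ex18iii S Γxμ).dagger (CategoryTheory.Prod.fst _ _ ⋙ Ξ)).R ⥤ (ex18iii S Γxμ).R).IsEquivalence :=
  Functor.Graph.toBase_isEquivalence _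

end Equivalence

end Literature.IUT.HodgeArakelov
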